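import Literature.AlgebraicGeometry.HodgeTheory.AlgebraicClassesHodgeTypeHolds
import HarnessLib

/-!
# An irreducible closed subvariety of codimension `l` supports a non-zero class of degree `2l`

Stub `stub_supportedClass_ne_zero` of the line `andre_motivated_split` for the crux
`HodgeBeyondAnchors` (stmt-HodgeConjecture-14054), ingredient (A) of the cone step of Chow's moving
lemma on the coniveau carrier: for `Y` smooth projective of dimension `n` over `ℂ` and `C ⊆ Y` closed
irreducible of codimension exactly `l ≥ 1` (every point of `C` has codimension `≥ l`, some point has
codimension `≤ l`), there is a NON-ZERO class `b ∈ H²ˡ(Y(ℂ); ℂ)` dying on `(Y ∖ C)(ℂ)` — in print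
`cl(C) ≠ 0` (Fulton, *Intersection Theory* §19.1 Lemma 19.1.1–19.1.2; Wirtinger, Griffiths–Harris
Ch. 0 §7).

The proof is the first half of the tree's
`Literature.AlgebraicGeometry.HodgeTheory.isOfHodgeType_of_restrictCompl_eq_zero_of_isIrreducible_of_isSmoothProjective`
verbatim: resolve `C = closure {η}` by `τ : V ⟶ Y` smooth projective with a stalk-surjective complex
point (`exists_resolution_stalkMap_surjective`), take `b := τ_* 1_V` (`complexGysin`), which is non-zero
(`complexGysin_one_ne_zero_of_stalkMap_surjective`, Wirtinger) and dies off `C ⊇ τ(V)`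
(`complexGysin_restrictCompl_eq_zero`). The only extra step is `coheight η = l` for the generic point
`η` of `C`: `η` specialises to every point of `C` and `coheight` is antitone.

## References

* [Fulton1998] W. Fulton, Intersection Theory (1998), §19.1 Lemma 19.1.1, Lemma 19.1.2.
* [GriffithsHarrisPrinciples1978] P. Griffiths, J. Harris, Principles of Algebraic Geometry (1978),
  Ch. 0 §7.
* [VoisinHodgeI2002] C. Voisin, Hodge Theory and Complex Algebraic Geometry I (CUP 2002), §11.1.2.
-/

set_option linter.dupNamespace false

noncomputable section

open CategoryTheory AlgebraicGeometry Order
open Literature.AlgebraicTopology.SingularHomology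
open Literature.AlgebraicGeometry.Motives Literature.AlgebraicGeometry.HodgeTheory

namespace Summit.HodgeConjecture.HodgeConjecture.Theorems.HodgeBeyondAnchors

/-- **The codimension of an irreducible closed set is the codimension of its generic point**: if every
point of the closed irreducible `C` has codimension `≥ l` and some point has codimension `≤ l`, then
the generic point `η` of `C` has codimension exactly `l` (`η` specialises to every `t ∈ C`, i.e.
`t ∈ closure {η}`, and `coheight` is antitone: `coheight η ≤ coheight t`).
[cite: Hartshorne1977, II Ex. 3.20] -/
theorem coheight_genericPoint_eq_of_forall_le_of_exists_le {Y : SchemeOver ℂ} {C : Set Y.left}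
    (hC : IsClosed C) (hCi : IsIrreducible C) {l : ℕ} (hCl : ∀ t ∈ C, (l : ℕ∞) ≤ coheight t)
    (hCl' : ∃ t ∈ C, coheight t ≤ (l : ℕ∞)) : coheight hCi.genericPoint = l := by
  have hη : IsGenericPoint hCi.genericPoint C := hCi.isGenericPoint_genericPoint hC
  obtain ⟨t, htC, htl⟩ := hCl'
  refine le_antisymm ?_ (hCl _ hη.mem)
  have htη : t ∈ closure ({hCi.genericPoint} : Set Y.left) := by
    rw [hη.def]
    exact htC
  exact (coheight_le_coheight_of_mem_closure htη).trans htl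

/-- **An irreducible closed subvariety of codimension `l` supports a non-zero class of degree `2l`**
(`cl(C) ≠ 0`). For `Y` smooth projective of dimension `n` over `ℂ`, `C ⊆ Y` closed irreducible with all
points of codimension `≥ l ≥ 1` and some point of codimension `≤ l`, there is `b ∈ H²ˡ(Y(ℂ); ℂ)` with
`b|_{(Y ∖ C)(ℂ)} = 0` and `b ≠ 0`: `b := τ_* 1_V` for a resolution `τ : V ⟶ Y` of `C` with a
stalk-surjective complex point (`exists_resolution_stalkMap_surjective`); `τ_* 1_V ≠ 0` by Wirtinger
(`complexGysin_one_ne_zero_of_stalkMap_surjective`) and `τ_* 1_V` dies off `C ⊇ τ(V)`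
(`complexGysin_restrictCompl_eq_zero`). Verbatim the first half of the tree's
`isOfHodgeType_of_restrictCompl_eq_zero_of_isIrreducible_of_isSmoothProjective`.
[cite: Fulton1998, §19.1 Lemma 19.1.1–19.1.2] [cite: GriffithsHarrisPrinciples1978, Ch. 0 §7] -/
theorem stub_supportedClass_ne_zero :
    ∀ ⦃n : ℕ⦄ ⦃Y : SchemeOver ℂ⦄, IsSmoothProjective n Y →
      ∀ ⦃C : Set Y.left⦄, IsClosed C → IsIrreducible C → ∀ ⦃l : ℕ⦄, 1 ≤ l →
        (∀ t ∈ C, (l : ℕ∞) ≤ coheight t) → (∃ t ∈ C, coheight t ≤ (l : ℕ∞)) →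
        ∃ b : complexBetti Y (2 * l), complexBetti.restrictCompl Y C (2 * l) b = 0 ∧ b ≠ 0 := by
  intro n Y hY C hC hCi l _hl hCl hCl'
  have hk : coheight hCi.genericPoint = l :=
    coheight_genericPoint_eq_of_forall_le_of_exists_le hC hCi hCl hCl'
  -- dimension and codimension of `C = closure {z}`
  set z := hCi.genericPoint with hzdef
  have hzC : z ∈ C := (hCi.isGenericPoint_genericPoint hC).mem
  obtain ⟨d, c, hzd, hzc, hdc⟩ := exists_height_eq_coheight_eq hY z
  obtain rfl : c = l := by
    rw [hzc] at hk
    exact_mod_cast hk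
  -- a resolution `τ : V ⟶ Y` of `C` with a stalk-surjective point `P`
  obtain ⟨V, τ, η, P, hV, hη, hτη, hτP⟩ := exists_resolution_stalkMap_surjective hY z hzd
  -- the orientation family of the complex orientations and its Gysin image of `1`
  let μ : OrientationFamily := fun _ _ hW ↦ (ComplexPoints.isOrientableOver ℂ hW).some
  have hμ : μ.HasPoincareDuality := OrientationFamily.hasPoincareDuality μ
  set y₀ : complexBetti Y (2 * c) := complexGysin μ hV hY τ (show 0 + 2 * n = 2 * c + 2 * d by omega)
    (singularCohomology.one ℂ (ComplexPoints V)) with hy₀def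
  -- `y₀ ≠ 0` (Wirtinger)
  have hy0 : y₀ ≠ 0 := complexGysin_one_ne_zero_of_stalkMap_surjective μ hY hV τ P hτP hdc
  -- `y₀` dies off `C`: `τ(V) ⊆ C`
  have hpre : τ.left.base ⁻¹' C = Set.univ := by
    refine Set.eq_univ_of_forall fun v ↦ ?_
    have hgen' := hη.image τ.left.continuous
    rw [Set.image_univ, hτη] at hgen'
    have h1 : τ.left.base v ∈ closure (Set.range τ.left.base) := subset_closure ⟨v, rfl⟩
    rw [← hgen'.def] at h1
    exact closure_minimal (Set.singleton_subset_iff.2 hzC) hC h1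
  have hy₀ker : complexBetti.restrictCompl Y C (2 * c) y₀ = 0 := by
    refine complexGysin_restrictCompl_eq_zero (gysinMap_restrictCompl_eq_zero_of_field ℂ) μ hμ hV hY τ
      _ hC _ ?_
    haveI : IsEmpty (complexPointsCompl V (τ.left.base ⁻¹' C)) :=
      ⟨fun P ↦ P.2 (Set.eq_univ_iff_forall.1 hpre _)⟩
    haveI := ModuleCat.subsingleton_of_isZero
      (isZero_singularCohomology_of_isEmpty ℂ ℂ (E := complexPointsCompl V (τ.left.base ⁻¹' C)) 0)
    exact Subsingleton.elim _ _
  exact ⟨y₀, hy₀ker, hy0⟩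

end Summit.HodgeConjecture.HodgeConjecture.Theorems.HodgeBeyondAnchors

end
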